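import Summits.NavierStokesRegularity.OSWSelfSimilar.SheetRResolventComplex
import Literature.Analysis.OperatorTheory.PseudoResolvent
import HarnessLib

/-!
# SHEET-ℝ frame, MODEL ASSEMBLY for Z3-SR-SPEC (P1): the first RESOLVENT IDENTITY for `R(σ)` and the pseudo-resolvent structure
# (hence holomorphy) on the half-plane `Re σ > −m`

HONEST FRAMING (cell ns-blowup GROUP B / zone Z3, case Z3-SR-SPEC, PAPER item (P1) and the analyticity clause «`σ ↦ R(σ)` holomorphic»
that the tree's pseudo-resolvent calculus (`Literature.Analysis.OperatorTheory.IsPseudoResolvent`, cert-4's `PseudoResolventRankOneEigenvalue`)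
is keyed on; 1-D MODEL certificate frame (viscous gCLM/OSW sheet on the line); not Euler/NS; «violates: none — MODEL»). Nothing here asserts
that a profile exists; the analytic input is the Gårding datum bundled in `SheetRResolventComplex.GardingData`.

For `z, w` in the half-plane and `G ∈ L²_w(ℂ)`, the `w`-solution `Φ = R(w)G` is, by the SHIFT of the potential (`linForm_shift`) and the
a.e. identification of `Re Φ`, `Im Φ` with the profiles of the pair solution, a weak solution of the `z`-system with data `G + (z − w)Φ`;
UNIQUENESS of energy-space weak solutions (`pairOp_unique`) then gives `R(z)(G + (z − w)Φ) = Φ` (`resolvent_absorb`), and `ℂ`-linearity of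
`R(z)` turns this into Kato's first resolvent identity

  `R(z) − R(w) = (w − z)·R(z)R(w)`      (`resolvent_sub`, `isPseudoResolvent`),

so `σ ↦ R(σ)` is a PSEUDO-RESOLVENT on `{Re σ > −m}` in the sense of Kato VIII-§1.1 and is therefore HOLOMORPHIC there
(`differentiableOn_resolvent`, from `IsPseudoResolvent.differentiableOn`).  KERNEL CAVEAT (why «pseudo»): the weak formulation tests against
ODD compactly supported energy-class functions, so `R(σ)` annihilates every datum orthogonal to them (e.g. even functions) — `R(σ)` is the
resolvent of the linearised operator ON THE ODD CLASS, and a pseudo-resolvent (constant kernel, Kato VIII-(1.2)) on all of `L²_w(ℂ)`.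

Pure functional analysis over the previous layers; no definition, no named fact.  WHAT THIS IS NOT: not NS; not the spectral certificate;
no number of record moves.
-/

noncomputable section

namespace Summit.NavierStokesRegularity.OSWSelfSimilar
namespace SheetRResolventIdentity

open _root_.MeasureTheory _root_.Set _root_.Filter _root_.Real SheetRWeakProfilePV SheetRWeakToStrong SheetREnergyClass SheetRWeightedMeasure
  SheetRLinearisedTests SheetREnergySpace SheetRTestSpace SheetRLinearisedFormBounds SheetRSolutionOperator SheetRLinearisedCutoffEnergy
  SheetRResolventPair SheetRComplexPivot SheetRResolventComplex Literature.Analysis.OperatorTheory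
open scoped Topology ENNReal

variable {L D₀ D₁ V₀ m : ℝ} {d V : ℝ → ℝ}

/-! ### §1 a.e. coordinates of `G + c·Φ` -/

/-- Real and imaginary parts of `G + c·Φ` in `L²_w(ℂ)`, Lebesgue-a.e.:
`Re(G + cΦ) = Re G + Re c·Re Φ − Im c·Im Φ`, `Im(G + cΦ) = Im G + Re c·Im Φ + Im c·Re Φ`. [folklore] -/
theorem reW_imW_add_smul_ae (hL : 0 < L) (G Φ : Wc L) (c : ℂ) :
    (((reW L (G + c • Φ) : W L) : ℝ → ℝ) =ᵐ[volume] fun y =>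
        ((reW L G : W L) : ℝ → ℝ) y + c.re * ((reW L Φ : W L) : ℝ → ℝ) y - c.im * ((imW L Φ : W L) : ℝ → ℝ) y) ∧
    (((imW L (G + c • Φ) : W L) : ℝ → ℝ) =ᵐ[volume] fun y =>
        ((imW L G : W L) : ℝ → ℝ) y + c.re * ((imW L Φ : W L) : ℝ → ℝ) y + c.im * ((reW L Φ : W L) : ℝ → ℝ) y) := by
  have hsum : (((G + c • Φ : Wc L)) : ℝ → ℂ) =ᵐ[μw L] fun y => (G : ℝ → ℂ) y + c * (Φ : ℝ → ℂ) y := by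
    filter_upwards [Lp.coeFn_add G (c • Φ), Lp.coeFn_smul c Φ] with y h1 h2
    rw [h1, Pi.add_apply, h2, Pi.smul_apply, smul_eq_mul]
  refine ⟨ae_volume_of_ae_μw hL ?_, ae_volume_of_ae_μw hL ?_⟩
  · filter_upwards [reW_ae (G + c • Φ), hsum, reW_ae G, reW_ae Φ, imW_ae Φ] with y h1 h2 h3 h4 h5
    rw [h1, h2, h3, h4, h5, Complex.add_re, Complex.mul_re]; ring
  · filter_upwards [imW_ae (G + c • Φ), hsum, imW_ae G, reW_ae Φ, imW_ae Φ] with y h1 h2 h3 h4 h5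
    rw [h1, h2, h3, h4, h5, Complex.add_im, Complex.mul_im]; ring

/-! ### §2 Absorption: `R(z)(G + (z − w)·R(w)G) = R(w)G` -/

/-- **Absorption.** For `z, w` in the half-plane and `G ∈ L²_w(ℂ)`: `resolvent z (G + (z − w)·resolvent w G) = resolvent w G` — the
`w`-solution solves the `z`-system with the shifted data (potential shift + a.e. identification of `Re/Im R(w)G` with the profiles), and
energy-space weak solutions are unique. [folklore] -/
theorem resolvent_absorb (hL : 0 < L) (h : GardingData L d V D₀ D₁ V₀ m) {z w : ℂ} (hz : -m < z.re) (hw : -m < w.re) (G : Wc L) :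
    resolvent hL h z (G + (z - w) • resolvent hL h w G) = resolvent hL h w G := by
  set Φ := resolvent hL h w G with hΦ
  obtain ⟨happw, hre, him, hweakw⟩ := resolvent_weak hL h hw G
  set P := pairOp hL h w hw (toPair L G) with hP
  -- `P` solves the `z`-system with data `toPair (G + (z − w)Φ)`
  have hsolves : ∀ v v₁ : ℝ → ℝ, IsCompactTest v v₁ →
      linForm L d (fun ξ => V ξ + z.re) (prim (der P.fst)) (der P.fst) v v₁
            - z.im * ∫ y, (L ^ 2 + y ^ 2) * (prim (der P.snd) y * v y) =
          ∫ y, (L ^ 2 + y ^ 2) * ((((toPair L (G + (z - w) • Φ)).fst : W L) : ℝ → ℝ) y * v y) ∧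
        linForm L d (fun ξ => V ξ + z.re) (prim (der P.snd)) (der P.snd) v v₁
            + z.im * ∫ y, (L ^ 2 + y ^ 2) * (prim (der P.fst) y * v y) =
          ∫ y, (L ^ 2 + y ^ 2) * ((((toPair L (G + (z - w) • Φ)).snd : W L) : ℝ → ℝ) y * v y) := by
    intro v v₁ hv
    obtain ⟨e1, e2⟩ := hweakw v v₁ hv
    obtain ⟨humR, hu₁mR, h0R, h1R, -, -⟩ := profile_facts hL P.fst
    obtain ⟨humI, hu₁mI, h0I, h1I, -, -⟩ := profile_facts hL P.snd
    -- shifts `V + z.re` and `V + w.re` against the base `V`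
    obtain ⟨hiR, hzR⟩ := linForm_shift h hL z.re hv humR hu₁mR h0R h1R
    obtain ⟨-, hwR⟩ := linForm_shift h hL w.re hv humR hu₁mR h0R h1R
    obtain ⟨hiI, hzI⟩ := linForm_shift h hL z.re hv humI hu₁mI h0I h1I
    obtain ⟨-, hwI⟩ := linForm_shift h hL w.re hv humI hu₁mI h0I h1I
    -- the data integrals
    obtain ⟨hc, -, -, -⟩ := basic_of_isCompactTest hv
    obtain ⟨hdre, hdim⟩ := reW_imW_add_smul_ae hL G Φ (z - w)
    obtain ⟨htf, hts⟩ := toPair_fst_snd (G + (z - w) • Φ)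
    have hiG1 := integrable_weight_mul_test hL (reW L G) hv
    have hiG2 := integrable_weight_mul_test hL (imW L G) hv
    have hdat1 : ∫ y, (L ^ 2 + y ^ 2) * ((((toPair L (G + (z - w) • Φ)).fst : W L) : ℝ → ℝ) y * v y) =
        (∫ y, (L ^ 2 + y ^ 2) * (((reW L G : W L) : ℝ → ℝ) y * v y))
          + (z - w).re * (∫ y, (L ^ 2 + y ^ 2) * (prim (der P.fst) y * v y))
          - (z - w).im * ∫ y, (L ^ 2 + y ^ 2) * (prim (der P.snd) y * v y) := by
      have e : ∫ y, (L ^ 2 + y ^ 2) * ((((toPair L (G + (z - w) • Φ)).fst : W L) : ℝ → ℝ) y * v y) =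
          ∫ y, ((L ^ 2 + y ^ 2) * (((reW L G : W L) : ℝ → ℝ) y * v y)
            + (z - w).re * ((L ^ 2 + y ^ 2) * (prim (der P.fst) y * v y))
            - (z - w).im * ((L ^ 2 + y ^ 2) * (prim (der P.snd) y * v y))) := by
        rw [htf]
        refine integral_congr_ae ?_
        filter_upwards [hdre, hre, him] with y hy hyr hyi
        rw [hy, hyr, hyi]; ring
      have hI12 : Integrable (fun y => (L ^ 2 + y ^ 2) * (((reW L G : W L) : ℝ → ℝ) y * v y)
          + (z - w).re * ((L ^ 2 + y ^ 2) * (prim (der P.fst) y * v y))) := hiG1.add (hiR.const_mul _)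
      rw [e, integral_sub hI12 (hiI.const_mul _), integral_add hiG1 (hiR.const_mul _),
        integral_const_mul, integral_const_mul]
    have hdat2 : ∫ y, (L ^ 2 + y ^ 2) * ((((toPair L (G + (z - w) • Φ)).snd : W L) : ℝ → ℝ) y * v y) =
        (∫ y, (L ^ 2 + y ^ 2) * (((imW L G : W L) : ℝ → ℝ) y * v y))
          + (z - w).re * (∫ y, (L ^ 2 + y ^ 2) * (prim (der P.snd) y * v y))
          + (z - w).im * ∫ y, (L ^ 2 + y ^ 2) * (prim (der P.fst) y * v y) := by
      have e : ∫ y, (L ^ 2 + y ^ 2) * ((((toPair L (G + (z - w) • Φ)).snd : W L) : ℝ → ℝ) y * v y) =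
          ∫ y, ((L ^ 2 + y ^ 2) * (((imW L G : W L) : ℝ → ℝ) y * v y)
            + (z - w).re * ((L ^ 2 + y ^ 2) * (prim (der P.snd) y * v y))
            + (z - w).im * ((L ^ 2 + y ^ 2) * (prim (der P.fst) y * v y))) := by
        rw [hts]
        refine integral_congr_ae ?_
        filter_upwards [hdim, hre, him] with y hy hyr hyi
        rw [hy, hyr, hyi]; ring
      have hI12 : Integrable (fun y => (L ^ 2 + y ^ 2) * (((imW L G : W L) : ℝ → ℝ) y * v y)
          + (z - w).re * ((L ^ 2 + y ^ 2) * (prim (der P.snd) y * v y))) := hiG2.add (hiI.const_mul _)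
      rw [e, integral_add hI12 (hiR.const_mul _), integral_add hiG2 (hiI.const_mul _),
        integral_const_mul, integral_const_mul]
    rw [hdat1, hdat2, hzR, hzI, Complex.sub_re, Complex.sub_im]
    rw [hwR] at e1
    rw [hwI] at e2
    constructor
    · linarith
    · linarith
  have huniq := pairOp_unique hL h z hz (toPair L (G + (z - w) • Φ)) hsolves
  obtain ⟨happz, -, -, -⟩ := resolvent_weak hL h hz (G + (z - w) • Φ)
  rw [happz, ← huniq, ← happw]

/-! ### §3 The first resolvent identity and the pseudo-resolvent structure -/

/-- **First resolvent identity** (Kato I-(5.5) with Mathlib's sign convention): for `z, w` in the half-plane,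
`resolvent z G − resolvent w G = (w − z)·resolvent z (resolvent w G)`. [folklore] -/
theorem resolvent_sub (hL : 0 < L) (h : GardingData L d V D₀ D₁ V₀ m) {z w : ℂ} (hz : -m < z.re) (hw : -m < w.re) (G : Wc L) :
    resolvent hL h z G - resolvent hL h w G = (w - z) • resolvent hL h z (resolvent hL h w G) := by
  have hab := resolvent_absorb hL h hz hw G
  rw [map_add, map_smul] at hab
  -- `R(z)G + (z − w)R(z)Φ = Φ`
  have h1 : resolvent hL h z G = resolvent hL h w G - (z - w) • resolvent hL h z (resolvent hL h w G) :=
    eq_sub_of_add_eq hab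
  rw [h1, ← neg_sub z w, neg_smul]
  abel

/-- **`σ ↦ R(σ)` is a pseudo-resolvent on the half-plane `{Re σ > −m}`** (Kato VIII-§1.1 (1.2)):
`R(z) − R(w) = (w − z)·R(z)R(w)` in the Banach algebra `L²_w(ℂ) →L[ℂ] L²_w(ℂ)`. [folklore] -/
theorem isPseudoResolvent (hL : 0 < L) (h : GardingData L d V D₀ D₁ V₀ m) :
    IsPseudoResolvent {σ : ℂ | -m < σ.re} (resolvent hL h) := by
  intro z hz w hw
  refine ContinuousLinearMap.ext fun G => ?_
  show resolvent hL h z G - resolvent hL h w G = (w - z) • resolvent hL h z (resolvent hL h w G)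
  exact resolvent_sub hL h hz hw G

/-- The half-plane `{Re σ > −m}` is open. [folklore] -/
theorem isOpen_halfPlane (m : ℝ) : IsOpen {σ : ℂ | -m < σ.re} :=
  isOpen_lt continuous_const Complex.continuous_re

/-- **Holomorphy**: `σ ↦ R(σ)` is complex-differentiable on the half-plane `{Re σ > −m}` (a pseudo-resolvent on an open set is holomorphic,
`IsPseudoResolvent.differentiableOn`). [folklore] -/
theorem differentiableOn_resolvent (hL : 0 < L) (h : GardingData L d V D₀ D₁ V₀ m) :
    DifferentiableOn ℂ (resolvent hL h) {σ : ℂ | -m < σ.re} :=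
  (isPseudoResolvent hL h).differentiableOn (isOpen_halfPlane m)

/-- The values of the resolvent commute: `R(z)R(w) = R(w)R(z)` on the half-plane. [folklore] -/
theorem resolvent_comm (hL : 0 < L) (h : GardingData L d V D₀ D₁ V₀ m) {z w : ℂ} (hz : -m < z.re) (hw : -m < w.re) :
    resolvent hL h z * resolvent hL h w = resolvent hL h w * resolvent hL h z :=
  (isPseudoResolvent hL h).comm hz hw

end SheetRResolventIdentity
end Summit.NavierStokesRegularity.OSWSelfSimilar

end
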